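/-
Origin: written from primary sources — A. Weil, *Sur certains groupes d'opérateurs unitaires*,
Acta Math. 111 (1964), Chap. III n° 41 (Thm 6, p. 193: invariance of `Θ` under the rational
points); R. Howe, *θ-series and invariant theory*, Proc. Sympos. Pure Math. 33.1 (1979) §2–§3
(see-saw / restriction of the oscillator representation to a product of commuting sub-pairs is the
tensor product of the two small oscillator representations up to a character). Adapted: no. The
content of this file is elementary linear algebra over the product-function vocabulary of
`AdelicSchwartzBruhatDirectSum` (`tensorToSum`, `thetaDistLM_tensorToSum`); it is the
"function half" of the two-factor scalar bookkeeping: once an analytic two-factor Schur lemma has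
produced, for each group element, ONE scalar `c` with `M (Φ₁ ⊠ Φ₂) = c • (A₁ Φ₁ ⊠ A₂ Φ₂)`, the
scalars are (i) unique, (ii) multiplicative along compositions, (iii) equal to `1` whenever the
three operators preserve the theta distribution (e.g. at rational points, Weil's Thm 6).
-/
import Mathlib
import Literature.NumberTheory.Automorphic.AdelicSchwartzBruhatDirectSum
import Literature.NumberTheory.Weil1964.AdelicThetaWitness

/-!
# The scalar in `M (Φ₁ ⊠ Φ₂) = c • (A₁ Φ₁ ⊠ A₂ Φ₂)`: uniqueness, multiplicativity, triviality

## Abstract part (any field `R`, any bilinear `t : S₁ → S₂ → S`)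

* `TensorScalar.eq_of_smul_eq_smul` — `c • x = d • x`, `x ≠ 0` ⇒ `c = d`.
* `TensorScalar.scalar_unique` — if `M (t a b) = c • t (A₁ a) (A₂ b) = d • t (A₁ a) (A₂ b)` at one
  pair with `t (A₁ a) (A₂ b) ≠ 0` then `c = d`.
* `TensorScalar.scalar_comp` — **multiplicativity**: if `M, M'` carry scalars `c, c'` against
  `(A₁, A₂)`, `(A₁', A₂')`, then `M ∘ M'` carries `c * c'` against `(A₁ ∘ A₁', A₂ ∘ A₂')`; hence any
  scalar `c''` of `M ∘ M'` against the composed pair equals `c * c'` as soon as ONE value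
  `t (A₁ (A₁' a)) (A₂ (A₂' b))` is nonzero (`TensorScalar.scalar_comp_eq_mul`).
* `TensorScalar.scalar_eq_one_of_functional` — **triviality**: if a functional `θ` on `S` is
  multiplicative on `t` through functionals `θ₁, θ₂` (`θ (t a b) = θ₁ a * θ₂ b`), and `θ ∘ M = θ`,
  `θ₁ ∘ A₁ = θ₁`, `θ₂ ∘ A₂ = θ₂`, and `θ₁, θ₂` are not identically zero, then `c = 1`.

## Adelic part (`K` a number field, `tensorToSum K ι₁ ι₂` of `AdelicSchwartzBruhatDirectSum`)

* `boxTensor_eq_zero_iff`, `tensorToSum_eq_zero_iff` — non-degeneracy: `Φ₁ ⊠ Φ₂ = 0 ↔ Φ₁ = 0 ∨ Φ₂ = 0`.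
* `tensorToSum_ne_zero`, `exists_tensorToSum_ne_zero` — for nonzero linear maps `B₁, B₂` some `B₁ Φ₁ ⊠ B₂ Φ₂ ≠ 0`.
* `tensorScalar_comp_eq_mul` — multiplicativity specialised to `tensorToSum`, with the
  non-vanishing side condition discharged from `B_j ≠ 0`.
* `tensorScalar_eq_one_of_thetaDistLM` — **`c = 1`** when `M, A₁, A₂` preserve `Θ`
  (`thetaDistLM`), using `Θ(Φ₁ ⊠ Φ₂) = Θ(Φ₁) Θ(Φ₂)` (`thetaDistLM_tensorToSum`) and Weil's witness
  `Θ(Φ₀) ≠ 0` (`thetaDist_thetaWitness_ne_zero`).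

All statements are kernel-proved; the bracketed tags record provenance only. No analytic input
(no Schur lemma, no continuity) is used or asserted here: the EXISTENCE of the scalars is the
hypothesis `hc`.
-/

open NumberField IsDedekindDomain
open scoped Classical

namespace Literature.NumberTheory.Automorphic

/-! ## Abstract scalar bookkeeping -/

namespace TensorScalar

variable {R : Type*} [Field R] {S₁ S₂ S : Type*} [AddCommGroup S₁] [Module R S₁]
  [AddCommGroup S₂] [Module R S₂] [AddCommGroup S] [Module R S]

/-- Over a field, `c • x = d • x` with `x ≠ 0` forces `c = d`. [folklore] -/
theorem eq_of_smul_eq_smul {c d : R} {x : S} (hx : x ≠ 0) (h : c • x = d • x) : c = d := by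
  have h' : (c - d) • x = 0 := by rw [sub_smul, h, sub_self]
  rcases smul_eq_zero.mp h' with hcd | hx0
  · exact sub_eq_zero.mp hcd
  · exact absurd hx0 hx

/-- Uniqueness of the scalar: two scalars relating `M (t a b)` to the same nonzero
`t (A₁ a) (A₂ b)` coincide. [folklore] -/
theorem scalar_unique (t : S₁ →ₗ[R] S₂ →ₗ[R] S) (M : S →ₗ[R] S) (A₁ : S₁ →ₗ[R] S₁)
    (A₂ : S₂ →ₗ[R] S₂) {c d : R} {a : S₁} {b : S₂} (hne : t (A₁ a) (A₂ b) ≠ 0)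
    (hc : M (t a b) = c • t (A₁ a) (A₂ b)) (hd : M (t a b) = d • t (A₁ a) (A₂ b)) : c = d :=
  eq_of_smul_eq_smul hne (hc.symm.trans hd)

/-- Composition carries the product scalar: if `M (t a b) = c • t (A₁ a) (A₂ b)` and
`M' (t a b) = c' • t (A₁' a) (A₂' b)` for all `a, b`, then
`(M ∘ M') (t a b) = (c * c') • t (A₁ (A₁' a)) (A₂ (A₂' b))`. [folklore] -/
theorem scalar_comp (t : S₁ →ₗ[R] S₂ →ₗ[R] S) (M M' : S →ₗ[R] S) (A₁ A₁' : S₁ →ₗ[R] S₁)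
    (A₂ A₂' : S₂ →ₗ[R] S₂) (c c' : R)
    (hc : ∀ a b, M (t a b) = c • t (A₁ a) (A₂ b))
    (hc' : ∀ a b, M' (t a b) = c' • t (A₁' a) (A₂' b)) (a : S₁) (b : S₂) :
    (M ∘ₗ M') (t a b) = (c * c') • t (A₁ (A₁' a)) (A₂ (A₂' b)) := by
  rw [LinearMap.comp_apply, hc', map_smul, hc, smul_smul, mul_comm]

/-- **Multiplicativity.** Any scalar `c''` of `M ∘ M'` against the composed pair equals `c * c'`,
provided one value `t (A₁ (A₁' a)) (A₂ (A₂' b))` is nonzero. (cf. R. Howe, θ-series and invariant theory (1979) §3) [folklore] -/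
theorem scalar_comp_eq_mul (t : S₁ →ₗ[R] S₂ →ₗ[R] S) (M M' : S →ₗ[R] S) (A₁ A₁' : S₁ →ₗ[R] S₁)
    (A₂ A₂' : S₂ →ₗ[R] S₂) (c c' c'' : R)
    (hc : ∀ a b, M (t a b) = c • t (A₁ a) (A₂ b))
    (hc' : ∀ a b, M' (t a b) = c' • t (A₁' a) (A₂' b))
    (hc'' : ∀ a b, (M ∘ₗ M') (t a b) = c'' • t (A₁ (A₁' a)) (A₂ (A₂' b)))
    (hne : ∃ a b, t (A₁ (A₁' a)) (A₂ (A₂' b)) ≠ 0) : c'' = c * c' := by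
  obtain ⟨a, b, hab⟩ := hne
  exact eq_of_smul_eq_smul hab ((hc'' a b).symm.trans (scalar_comp t M M' A₁ A₁' A₂ A₂' c c' hc hc' a b))

/-- **Triviality from an invariant multiplicative functional.** If `θ (t a b) = θ₁ a * θ₂ b`,
the three operators preserve `θ, θ₁, θ₂`, and `θ₁, θ₂` are not identically zero, then the scalar
is `1`. (Model case: `θ = Θ` the theta distribution, `M, A₁, A₂` the Weil operators of a rational
element.) [cite: Weil1964, Chap. III n° 41, Thm 6 p. 193] -/
theorem scalar_eq_one_of_functional (t : S₁ →ₗ[R] S₂ →ₗ[R] S) (M : S →ₗ[R] S)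
    (A₁ : S₁ →ₗ[R] S₁) (A₂ : S₂ →ₗ[R] S₂) (c : R)
    (hc : ∀ a b, M (t a b) = c • t (A₁ a) (A₂ b))
    (θ : S →ₗ[R] R) (θ₁ : S₁ →ₗ[R] R) (θ₂ : S₂ →ₗ[R] R)
    (hθ : ∀ a b, θ (t a b) = θ₁ a * θ₂ b) (hM : ∀ x, θ (M x) = θ x)
    (hA₁ : ∀ a, θ₁ (A₁ a) = θ₁ a) (hA₂ : ∀ b, θ₂ (A₂ b) = θ₂ b)
    (h₁ : ∃ a, θ₁ a ≠ 0) (h₂ : ∃ b, θ₂ b ≠ 0) : c = 1 := by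
  obtain ⟨a, ha⟩ := h₁
  obtain ⟨b, hb⟩ := h₂
  have key : θ₁ a * θ₂ b = c * (θ₁ a * θ₂ b) := by
    calc θ₁ a * θ₂ b = θ (t a b) := (hθ a b).symm
      _ = θ (M (t a b)) := (hM _).symm
      _ = c * θ (t (A₁ a) (A₂ b)) := by rw [hc, map_smul, smul_eq_mul]
      _ = c * (θ₁ a * θ₂ b) := by rw [hθ, hA₁, hA₂]
  have hne : θ₁ a * θ₂ b ≠ 0 := mul_ne_zero ha hb
  have : (c - 1) * (θ₁ a * θ₂ b) = 0 := by rw [sub_mul, one_mul, ← key, sub_self]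
  rcases mul_eq_zero.mp this with h | h
  · exact sub_eq_zero.mp h
  · exact absurd h hne

end TensorScalar

/-! ## Adelic specialisation: `tensorToSum` is non-degenerate; `Θ`-invariance forces `c = 1` -/

section Adelic

open Literature.NumberTheory.Weil1964

variable {K : Type} [Field K] [NumberField K] {ι₁ ι₂ : Type}

/-- Non-degeneracy of `⊠` on functions: `Φ₁ ⊠ Φ₂ = 0 ↔ Φ₁ = 0 ∨ Φ₂ = 0`. [folklore] -/
theorem boxTensor_eq_zero_iff (Φ₁ : (ι₁ → AdeleRing (𝓞 K) K) → ℂ)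
    (Φ₂ : (ι₂ → AdeleRing (𝓞 K) K) → ℂ) : boxTensor Φ₁ Φ₂ = 0 ↔ Φ₁ = 0 ∨ Φ₂ = 0 := by
  constructor
  · intro h
    by_contra hne
    obtain ⟨h₁, h₂⟩ := not_or.mp hne
    obtain ⟨x₁, hx₁⟩ := Function.ne_iff.mp h₁
    obtain ⟨x₂, hx₂⟩ := Function.ne_iff.mp h₂
    have := congr_fun h (Sum.elim x₁ x₂)
    rw [boxTensor_elim, Pi.zero_apply] at this
    exact mul_ne_zero hx₁ hx₂ this
  · rintro (h | h)
    · subst h; exact boxTensor_zero_left Φ₂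
    · subst h; exact boxTensor_zero_right Φ₁

variable [Fintype ι₁] [Fintype ι₂]

/-- Non-degeneracy of the bundled `tensorToSum`: `Φ₁ ⊠ Φ₂ = 0 ↔ Φ₁ = 0 ∨ Φ₂ = 0` in
`𝒮(𝔸_K^{ι₁ ⊕ ι₂})`. [folklore] -/
theorem tensorToSum_eq_zero_iff (Φ₁ : piSchwartzBruhat K ι₁) (Φ₂ : piSchwartzBruhat K ι₂) :
    tensorToSum K ι₁ ι₂ Φ₁ Φ₂ = 0 ↔ Φ₁ = 0 ∨ Φ₂ = 0 := by
  rw [← Submodule.coe_eq_zero, coe_tensorToSum, boxTensor_eq_zero_iff, Submodule.coe_eq_zero,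
    Submodule.coe_eq_zero]

/-- `Φ₁ ⊠ Φ₂ ≠ 0` for nonzero factors. [folklore] -/
theorem tensorToSum_ne_zero {Φ₁ : piSchwartzBruhat K ι₁} {Φ₂ : piSchwartzBruhat K ι₂}
    (h₁ : Φ₁ ≠ 0) (h₂ : Φ₂ ≠ 0) : tensorToSum K ι₁ ι₂ Φ₁ Φ₂ ≠ 0 := by
  rw [Ne, tensorToSum_eq_zero_iff, not_or]
  exact ⟨h₁, h₂⟩

/-- For nonzero linear maps `B₁, B₂` there is a pair with `B₁ Φ₁ ⊠ B₂ Φ₂ ≠ 0` (the side condition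
of multiplicativity). [folklore] -/
theorem exists_tensorToSum_ne_zero (B₁ : piSchwartzBruhat K ι₁ →ₗ[ℂ] piSchwartzBruhat K ι₁)
    (B₂ : piSchwartzBruhat K ι₂ →ₗ[ℂ] piSchwartzBruhat K ι₂) (h₁ : B₁ ≠ 0) (h₂ : B₂ ≠ 0) :
    ∃ Φ₁ Φ₂, tensorToSum K ι₁ ι₂ (B₁ Φ₁) (B₂ Φ₂) ≠ 0 := by
  obtain ⟨Φ₁, hΦ₁⟩ : ∃ Φ₁, B₁ Φ₁ ≠ 0 := by
    by_contra h
    exact h₁ (LinearMap.ext fun x => not_not.mp fun hx => h ⟨x, hx⟩)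
  obtain ⟨Φ₂, hΦ₂⟩ : ∃ Φ₂, B₂ Φ₂ ≠ 0 := by
    by_contra h
    exact h₂ (LinearMap.ext fun x => not_not.mp fun hx => h ⟨x, hx⟩)
  exact ⟨Φ₁, Φ₂, tensorToSum_ne_zero hΦ₁ hΦ₂⟩

/-- **Multiplicativity of the two-factor scalar on `𝒮(𝔸_K^{ι₁ ⊕ ι₂})`.** If
`M (Φ₁ ⊠ Φ₂) = c • (A₁ Φ₁ ⊠ A₂ Φ₂)`, `M' (Φ₁ ⊠ Φ₂) = c' • (A₁' Φ₁ ⊠ A₂' Φ₂)` and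
`(M ∘ M') (Φ₁ ⊠ Φ₂) = c'' • (A₁ A₁' Φ₁ ⊠ A₂ A₂' Φ₂)` for all `Φ₁, Φ₂`, with `A₁ ∘ A₁' ≠ 0` and
`A₂ ∘ A₂' ≠ 0`, then `c'' = c * c'`. (Instantiate with `M = ω(g)`, `M' = ω(h)` and
`M ∘ M' = ω(gh)` for representations `ω, ω₁, ω₂`.) (cf. R. Howe, θ-series and invariant theory (1979) §3) [folklore] -/
theorem tensorScalar_comp_eq_mul
    (M M' : piSchwartzBruhat K (ι₁ ⊕ ι₂) →ₗ[ℂ] piSchwartzBruhat K (ι₁ ⊕ ι₂))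
    (A₁ A₁' : piSchwartzBruhat K ι₁ →ₗ[ℂ] piSchwartzBruhat K ι₁)
    (A₂ A₂' : piSchwartzBruhat K ι₂ →ₗ[ℂ] piSchwartzBruhat K ι₂) (c c' c'' : ℂ)
    (hc : ∀ Φ₁ Φ₂, M (tensorToSum K ι₁ ι₂ Φ₁ Φ₂) = c • tensorToSum K ι₁ ι₂ (A₁ Φ₁) (A₂ Φ₂))
    (hc' : ∀ Φ₁ Φ₂, M' (tensorToSum K ι₁ ι₂ Φ₁ Φ₂) = c' • tensorToSum K ι₁ ι₂ (A₁' Φ₁) (A₂' Φ₂))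
    (hc'' : ∀ Φ₁ Φ₂, (M ∘ₗ M') (tensorToSum K ι₁ ι₂ Φ₁ Φ₂) =
      c'' • tensorToSum K ι₁ ι₂ (A₁ (A₁' Φ₁)) (A₂ (A₂' Φ₂)))
    (h₁ : A₁ ∘ₗ A₁' ≠ 0) (h₂ : A₂ ∘ₗ A₂' ≠ 0) : c'' = c * c' :=
  TensorScalar.scalar_comp_eq_mul (tensorToSum K ι₁ ι₂) M M' A₁ A₁' A₂ A₂' c c' c'' hc hc' hc''
    (by simpa only [LinearMap.comp_apply] using exists_tensorToSum_ne_zero _ _ h₁ h₂)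

variable (K) in
/-- Weil's witness as an element of `𝒮(𝔸_K^ι)`, with `Θ ≠ 0`. [cite: Weil1964, n° 41] -/
theorem exists_thetaDistLM_ne_zero (ι : Type) [Fintype ι] :
    ∃ Φ : piSchwartzBruhat K ι, thetaDistLM K ι Φ ≠ 0 :=
  ⟨⟨thetaWitness K ι, thetaWitness_mem K ι⟩, by
    rw [thetaDistLM_apply]; exact thetaDist_thetaWitness_ne_zero K ι⟩

/-- **Triviality of the two-factor scalar under `Θ`-invariance.** If
`M (Φ₁ ⊠ Φ₂) = c • (A₁ Φ₁ ⊠ A₂ Φ₂)` for all `Φ₁, Φ₂` and the three operators preserve the theta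
distribution (`Θ ∘ M = Θ`, `Θ ∘ A_j = Θ` — e.g. the Weil operators of a RATIONAL element, Weil's
Thm 6), then `c = 1`: `Θ(Φ₁)Θ(Φ₂) = Θ(M(Φ₁ ⊠ Φ₂)) = c Θ(A₁Φ₁)Θ(A₂Φ₂) = c Θ(Φ₁)Θ(Φ₂)` and
`Θ(Φ₀) ≠ 0` for Weil's witness. [cite: Weil1964, Chap. III n° 41, Thm 6 p. 193] -/
theorem tensorScalar_eq_one_of_thetaDistLM
    (M : piSchwartzBruhat K (ι₁ ⊕ ι₂) →ₗ[ℂ] piSchwartzBruhat K (ι₁ ⊕ ι₂))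
    (A₁ : piSchwartzBruhat K ι₁ →ₗ[ℂ] piSchwartzBruhat K ι₁)
    (A₂ : piSchwartzBruhat K ι₂ →ₗ[ℂ] piSchwartzBruhat K ι₂) (c : ℂ)
    (hc : ∀ Φ₁ Φ₂, M (tensorToSum K ι₁ ι₂ Φ₁ Φ₂) = c • tensorToSum K ι₁ ι₂ (A₁ Φ₁) (A₂ Φ₂))
    (hM : ∀ Φ, thetaDistLM K (ι₁ ⊕ ι₂) (M Φ) = thetaDistLM K (ι₁ ⊕ ι₂) Φ)
    (hA₁ : ∀ Φ, thetaDistLM K ι₁ (A₁ Φ) = thetaDistLM K ι₁ Φ)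
    (hA₂ : ∀ Φ, thetaDistLM K ι₂ (A₂ Φ) = thetaDistLM K ι₂ Φ) : c = 1 :=
  TensorScalar.scalar_eq_one_of_functional (tensorToSum K ι₁ ι₂) M A₁ A₂ c hc
    (thetaDistLM K (ι₁ ⊕ ι₂)) (thetaDistLM K ι₁) (thetaDistLM K ι₂) thetaDistLM_tensorToSum
    hM hA₁ hA₂ (exists_thetaDistLM_ne_zero K ι₁) (exists_thetaDistLM_ne_zero K ι₂)

/-- Corollary (the shape used by the splitting normalisation): a family of scalars `c : G → ℂ`
attached to maps `ω, ω₁, ω₂` from a monoid `G` that are multiplicative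
(`ω (g * h) = ω g ∘ ω h`, likewise `ω₁, ω₂`) with `ω_j g` never the zero map, satisfies
`c (g * h) = c g * c h`. (cf. R. Howe, θ-series and invariant theory (1979) §3) [folklore] -/
theorem tensorScalar_map_mul {G : Type*} [Monoid G]
    (ω : G → piSchwartzBruhat K (ι₁ ⊕ ι₂) →ₗ[ℂ] piSchwartzBruhat K (ι₁ ⊕ ι₂))
    (ω₁ : G → piSchwartzBruhat K ι₁ →ₗ[ℂ] piSchwartzBruhat K ι₁)
    (ω₂ : G → piSchwartzBruhat K ι₂ →ₗ[ℂ] piSchwartzBruhat K ι₂)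
    (hω : ∀ g h, ω (g * h) = ω g ∘ₗ ω h) (hω₁ : ∀ g h, ω₁ (g * h) = ω₁ g ∘ₗ ω₁ h)
    (hω₂ : ∀ g h, ω₂ (g * h) = ω₂ g ∘ₗ ω₂ h) (hne₁ : ∀ g, ω₁ g ≠ 0) (hne₂ : ∀ g, ω₂ g ≠ 0)
    (c : G → ℂ)
    (hc : ∀ g Φ₁ Φ₂, ω g (tensorToSum K ι₁ ι₂ Φ₁ Φ₂) =
      c g • tensorToSum K ι₁ ι₂ (ω₁ g Φ₁) (ω₂ g Φ₂)) (g h : G) :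
    c (g * h) = c g * c h := by
  refine tensorScalar_comp_eq_mul (ω g) (ω h) (ω₁ g) (ω₁ h) (ω₂ g) (ω₂ h) (c g) (c h) (c (g * h))
    (hc g) (hc h) (fun Φ₁ Φ₂ => ?_) (by rw [← hω₁]; exact hne₁ _) (by rw [← hω₂]; exact hne₂ _)
  rw [← hω, hc, ← LinearMap.comp_apply (ω₁ g), ← hω₁, ← LinearMap.comp_apply (ω₂ g), ← hω₂]

/-- Corollary: with `ω 1 = id`, `ω_j 1 = id`, the scalar at `1` is `1`. [folklore] -/
theorem tensorScalar_map_one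
    (M : piSchwartzBruhat K (ι₁ ⊕ ι₂) →ₗ[ℂ] piSchwartzBruhat K (ι₁ ⊕ ι₂))
    (A₁ : piSchwartzBruhat K ι₁ →ₗ[ℂ] piSchwartzBruhat K ι₁)
    (A₂ : piSchwartzBruhat K ι₂ →ₗ[ℂ] piSchwartzBruhat K ι₂) (c : ℂ)
    (hM : M = LinearMap.id) (hA₁ : A₁ = LinearMap.id) (hA₂ : A₂ = LinearMap.id)
    (hc : ∀ Φ₁ Φ₂, M (tensorToSum K ι₁ ι₂ Φ₁ Φ₂) = c • tensorToSum K ι₁ ι₂ (A₁ Φ₁) (A₂ Φ₂)) :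
    c = 1 := by
  subst hM hA₁ hA₂
  obtain ⟨Φ₁, h₁⟩ := exists_thetaDistLM_ne_zero K ι₁
  obtain ⟨Φ₂, h₂⟩ := exists_thetaDistLM_ne_zero K ι₂
  have hΦ₁ : Φ₁ ≠ 0 := fun h => h₁ (by rw [h, map_zero])
  have hΦ₂ : Φ₂ ≠ 0 := fun h => h₂ (by rw [h, map_zero])
  have := hc Φ₁ Φ₂
  simp only [LinearMap.id_apply] at this
  exact (TensorScalar.eq_of_smul_eq_smul (tensorToSum_ne_zero hΦ₁ hΦ₂)
    ((one_smul ℂ _).trans this)).symm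

end Adelic

end Literature.NumberTheory.Automorphic
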